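import Summits.QuantumFields.YangMills.Theorems.BalabanUVNodesN18KingModelScalesPair

/-!
# BalabanUVNodes ∕ N18 — King's (3.75): the HÖLDER-QUOTIENT bounds of Prop. 3.9, `j ≥ 1`, for King's ACTUAL operators on
# Bałaban's tori, UNCONDITIONAL — n18-b's file 13 `King1986/MinimizerHolderDecay` ((3.71) lines 3–4 in their printed shape)
# consumed BY NAME through the pair-anchored knit `N18KingModelScalesPair` ⟹ MULTI-SCALE inhabitants of
# `T4OutputRate.NE5` with `θ = L^{−γ∕2} < 1`, `κ > 0` (Track A, DAG node N18 = NE5 `T4OutputRate.NE5 EA EB W κ θ C₅` :211;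
# cluster K4; the -a∕-b loop on the PRINTED MODEL, fifth display)

HONEST FRAMING.  Count-neutral kernel bookkeeping (seat pub-ymgap-dag-n18-a g5; `--supports stmt-QuantumFields-19182`).
King's A = 0 scalar MODEL of the NE5 mechanism (template literature, published and proved) — NOT Bałaban's covariant
one-step outputs `E^{(j)}(X; g, U)`, for which NE5 is NOT IN PRINT and has no tree producer (NODE O 0∕1); NOT a node
discharge; finite tori; nothing continuum ∕ ℝ⁴ ∕ OS ∕ mass-gap ∕ Clay.  THEOREMS ONLY: 0 `def`, 0 `sorry`, standard axioms.

THE POINT.  King p. 665, Prop. 3.9: «For 0 ≦ j ≦ k − 1, 0 < α < 1, and γ sufficiently small, … |(∂_α(x′, y′)G^{η′}_{(j)})(z′)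
− (∂_α(x, y)G^η_{(j)})(z)|, |(∂_α(x′, y′)∂^{η′}_μG^{η′}_{(j)})(z′) − (∂_α(x, y)∂^η_μG^η_{(j)})(z)| ≦ CL^{−γk}{(L^jη)^{2−d−α−γ},
(L^jη)^{1−d−α−γ}} exp[−δ₀ dist({x, y}, z)]. (3.75)».  With (4.42) the Hölder quotient `∂_α(x, y)` ((3.62)) lands on the left
row of the three-factor graph: `(∂_α(x, y)G^{(j)}_k)(z) = Σ_{u,w} [|x − y|^{−α}(ℋ_j(x, u) − ℋ_j(y, u))]·C^{(j)}(u, w)·ℋ_j(z, w)`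
(second line: `∂^η_μ` inside the bracket).  The rows are n18-b's file 13 BY NAME — `holder_kernel_decay_blocks` ∕
`king_prop38_holder_torus_blocks` (Theorem 3.3 (3.8) and (3.71) line 3 for the ACTUAL `ℋ_K = a_KG^η_KQ^*_K`, decay from the
PAIR of blocks `min(|B(x) − b|, |B(y) − b|)`), `holder_dkernel_decay_blocks` ∕ `king_prop38_holder_deriv_torus_blocks` (line
4); the columns are file 8's `minimiser_col_decay` ∕ `minimiser_row_rate`; the middle line and the assembly are
`N18KingModelScalesPair.ne5_of_threeFactorRates_lemma45_pair`; the constants are made `K, n`-free by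
`fprop38Const_le_unif` ∕ `sqrt_rate_le_unif`:
* §1 **`ne5_kingModel_threeFactorHolder_torus`** — (3.75) FIRST line, `j ≥ 1`, `0 < α`, `0 < γ`, `α + γ ≤ 1`:
  `∃ κ > 0, C₅ ≥ 0 (d, L, a, m², γ, α only) ∀ n ≥ 1 ∀ tori ∀ carriers (scale ≥ 1; three fine points x_A, y_A, z_A under
  x_B, y_B, z_B; d X ≤ min(|B(x_A) − B(z_A)|, |B(y_A) − B(z_A)|)) ∀ read-outs ∀ W, NE5 EA EB W κ (L^{−γ∕2}) C₅`.
* §2 `ne5_kingModel_threeFactorHolder_inhabited` — §1 on King's own LITERAL carriers (`d X` = the actual `dist` of the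
  blocks): the read-out binders are jointly satisfiable with a non-idle decay factor.
The SECOND line of (3.75) (`∂^η_μ` inside the Hölder quotient, `α + γ < 1`) is the sibling file
`BalabanUVNodesN18KingModelTorusHolderDeriv` (same composition, `holder_dkernel_decay_blocks` ∕ `king_prop38_holder_deriv_torus_blocks`).
With files 9 (`N18KingModelTorus`), 11 (`N18KingModelTorusDeriv`) and these two, EVERY displayed bound of Prop. 3.9 for the
scalar propagators `G_{(j)}`, `j ≥ 1` — (3.73) both entries, (3.75) both entries — is a multi-scale `NE5` inhabitant in
the kernel for King's actual operators on Bałaban's tori.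
NOT COVERED ∕ PINS (standing, ref-B READ #66∕#73∕#110∕#238): A = 0, `g`∕`U` unread; periodic b.c.; the `j = 0` piece
(Prop. 3.7 — n18-b's files 14a∕14b∕14c in flight); King's rescaling (2.20) and the powers `(L^jη)^{…}` (we stay on the unit
lattice of scale `j`); sup torus distance in unit coordinates for `|x − y|` (file 12's `holdist`); (3.74) (the contour
operator `G(Γ, b)` of the vector field — not a scalar-template object, not in the tree); vertex functions; the bearing on
Bałaban's `E^{(j)}(X; g, U)` is NIL (NODE O + rows NE2∕NE3, seat README «No tree producer»).

Sources: C. King, Commun. Math. Phys. **102** (1986) 649–677 [King1986] — Prop. 3.9 (3.75) p. 665 (page image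
`b2b-balaban-template/king-renders/1986-cmp102-king-u1-higgs-I-p017-x2.png` read as an image by this seat), (3.62) p. 663,
(4.42)–(4.43) p. 675, Prop. 3.8 (3.71) p. 664, Lemma 4.5 (4.38) p. 674, Thm 3.3 (3.8) p. 658; T. Bałaban, Commun. Math.
Phys. **89** (1983) 571–597 [Balaban1983RegularityDecay] Thm (1.10) p. 573 (the decay input, via n18-b's chain); T. Bałaban,
Commun. Math. Phys. **109** (1987) 249–301 [Balaban1987RG1] — Thm 1 p. 259 (uniformity in ε, the only printed trace of NE5).
No claim about the mass gap.
-/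

noncomputable section

namespace Summit.QuantumFields.YangMills.BalabanUVNodes.N18KingModelTorusHolder

open Real Matrix
open Literature.MathematicalPhysics.QuantumFieldTheory.Balaban1983to89 (Params)
open Literature.MathematicalPhysics.QuantumFieldTheory.Balaban1983to89.T4OutputRate (Carriers Functional NE5)
open Literature.MathematicalPhysics.QuantumFieldTheory.Balaban1983to89.B5Prop11Plancherel (Tor fine unitVec)
open Literature.MathematicalPhysics.QuantumFieldTheory.Balaban1983to89.B4Sect5Proof (latticeConst latticeConst_nonneg)
open Literature.MathematicalPhysics.QuantumFieldTheory.King1986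
  (aK lemma43Const prop38RateConst prop38PosConst fprop38RateConst fprop38PosConst exp_decay_mono)
open Literature.MathematicalPhysics.QuantumFieldTheory.King1986.Torus
  (minimiser effLaplacian blockProj blockOf blockOf_over tdistT tdistT_symm tdistT_nonneg holdist K45 K45_nonneg delta45
    gam0L gam0L_pos delta45_pos minimiser_col_decay minimiser_row_rate holder_kernel_decay_blocks
    king_prop38_holder_torus_blocks)
open Summit.QuantumFields.YangMills.BalabanUVNodes.N18KingModel (coarse_val)
open Summit.QuantumFields.YangMills.BalabanUVNodes.N18KingModelTorus (outerRate_le_unif)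
open Summit.QuantumFields.YangMills.BalabanUVNodes.N18KingModelScalesPair
  (ne5_of_threeFactorRates_lemma45_pair fprop38Const_le_unif sqrt_rate_le_unif aliasConst_nonneg_of_lt_one)

variable {d : ℕ}

/-! ## §1 (3.75), first line, `j ≥ 1`, on Bałaban's tori: every outer line BY NAME -/

/-- **KING'S (3.75), FIRST LINE (THE HÖLDER QUOTIENT `∂_α(x, y)` ON THE LEFT EXTERNAL LINE), `j ≥ 1`, AS A MULTI-SCALE
INHABITANT OF N18's DECL OF RECORD — UNCONDITIONAL FOR KING'S ACTUAL OPERATORS ON BAŁABAN'S TORI.**  For `d ≥ 1`, odd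
`L > 1`, `a > 0`, `m² > 0`, `0 < α`, `0 < γ`, `α + γ ≤ 1` there are `κ > 0`, `C₅ ≥ 0` (functions of `d, L, a, m², γ, α`
only) such that: for every `n ≥ 1`; every scale-indexed family of unit tori with `L·M_j(μ) = 2L^{m_j}`; every carriers `C`
with `1 ≤ scale X` whose domain `X` of scale `j` reads THREE fine points `x_A(X)`, `y_A(X)` (the Hölder pair), `z_A(X)` of
`T_η` UNDER `x_B(X)`, `y_B(X)`, `z_B(X) ∈ T_{η′}` and has tree length at most King's `dist({B(x_A), B(y_A)}, B(z_A))` on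
`T₁`; every two functionals reading the (4.42) graphs with the HÖLDER row — run A
`Σ_{u,w} |x_A − y_A|^{−α}(ℋ_j(x_A, u) − ℋ_j(y_A, u))·C^{(j)}(u, w)·ℋ_j(z_A, w)` (`|x − y|` = `holdist`, the sup torus distance
in unit coordinates), run B the same at `j + n` with primes (King's ACTUAL `A = 0` operators of the tree); every window:
`NE5 EA EB W κ (L^{−γ∕2}) C₅`.  Composition: `ne5_of_threeFactorRates_lemma45_pair` at `γ∕2` with `hu` ≔
`holder_kernel_decay_blocks`, `hdu` ≔ `king_prop38_holder_torus_blocks` ∘ `fprop38Const_le_unif` ∘ `sqrt_rate_le_unif`,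
`hv` ≔ `minimiser_col_decay` ∘ `blockOf_over`, `hdv` ≔ `minimiser_row_rate` ∘ `outerRate_le_unif` ∘ `tdistT_symm`, common
rate `κ = min(δ^{H}, δ₀^{col}, δ^{H,rate}∕2, δ₀^{rate}∕2, δ₄₅)`.
[cite: King1986, Prop. 3.9 (3.75) p.665, (3.62) p.663, (4.42)–(4.43) p.675, Prop. 3.8 (3.71) p.664] -/
theorem ne5_kingModel_threeFactorHolder_torus (hd : 1 ≤ d) (L : ℕ) [NeZero L] (hLp : Odd L ∧ 1 < L) {a m2 : ℝ}
    (ha : 0 < a) (hm : 0 < m2) {α γ : ℝ} (hα : 0 < α) (hγ : 0 < γ) (hαγ : α + γ ≤ 1) :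
    ∃ κ C₅ : ℝ, 0 < κ ∧ 0 ≤ C₅ ∧
      ∀ (n : ℕ) (_hn : 1 ≤ n) (M : ℕ → Fin d → ℕ) [∀ j μ, NeZero (M j μ)]
        (_hM : ∀ j, ∃ mm : ℕ, ∀ μ, L * M j μ = 2 * L ^ mm)
        (C : Carriers) (_hsc : ∀ X, 1 ≤ C.scale X)
        (xA yA zA : (X : C.Dom) → Tor (fine (L ^ C.scale X) (fine L (M (C.scale X)))))
        (xB yB zB : (X : C.Dom) → Tor (fine (L ^ n * L ^ C.scale X) (fine L (M (C.scale X)))))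
        (_hx : ∀ X μ, (xA X μ).val = (xB X μ).val / L ^ n)
        (_hy : ∀ X μ, (yA X μ).val = (yB X μ).val / L ^ n)
        (_hz : ∀ X μ, (zA X μ).val = (zB X μ).val / L ^ n)
        (_hd : ∀ X, C.d X ≤ min
            (tdistT (fine L (M (C.scale X))) (blockOf (L ^ C.scale X) (fine L (M (C.scale X))) (xA X))
              (blockOf (L ^ C.scale X) (fine L (M (C.scale X))) (zA X)))
            (tdistT (fine L (M (C.scale X))) (blockOf (L ^ C.scale X) (fine L (M (C.scale X))) (yA X))
              (blockOf (L ^ C.scale X) (fine L (M (C.scale X))) (zA X))))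
        (EA : Functional C C.BgA) (EB : Functional C C.BgB)
        (_hEA : ∀ g U X, EA g U X =
          (fun u => (holdist (L ^ C.scale X) (fine L (M (C.scale X))) (xA X) (yA X)) ^ (-α)
              * (minimiser (L ^ C.scale X) (fine L (M (C.scale X))) (aK a L (C.scale X))
                    (((L ^ C.scale X : ℕ) : ℝ) ^ 2) m2 (Pi.single u 1) (xA X)
                  - minimiser (L ^ C.scale X) (fine L (M (C.scale X))) (aK a L (C.scale X))
                    (((L ^ C.scale X : ℕ) : ℝ) ^ 2) m2 (Pi.single u 1) (yA X)))
            ⬝ᵥ ((effLaplacian (L ^ C.scale X) (fine L (M (C.scale X))) (aK a L (C.scale X))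
                    (((L ^ C.scale X : ℕ) : ℝ) ^ 2) m2
                  + (a * ((L : ℝ) ^ 2)⁻¹) • blockProj L (M (C.scale X)))⁻¹
                *ᵥ fun w => minimiser (L ^ C.scale X) (fine L (M (C.scale X))) (aK a L (C.scale X))
                    (((L ^ C.scale X : ℕ) : ℝ) ^ 2) m2 (Pi.single w 1) (zA X)))
        (_hEB : ∀ g U X, EB g U X =
          (fun u => (holdist (L ^ n * L ^ C.scale X) (fine L (M (C.scale X))) (xB X) (yB X)) ^ (-α)
              * (minimiser (L ^ n * L ^ C.scale X) (fine L (M (C.scale X))) (aK a L (C.scale X + n))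
                    (((L ^ n * L ^ C.scale X : ℕ) : ℝ) ^ 2) m2 (Pi.single u 1) (xB X)
                  - minimiser (L ^ n * L ^ C.scale X) (fine L (M (C.scale X))) (aK a L (C.scale X + n))
                    (((L ^ n * L ^ C.scale X : ℕ) : ℝ) ^ 2) m2 (Pi.single u 1) (yB X)))
            ⬝ᵥ ((effLaplacian (L ^ n * L ^ C.scale X) (fine L (M (C.scale X))) (aK a L (C.scale X + n))
                    (((L ^ n * L ^ C.scale X : ℕ) : ℝ) ^ 2) m2
                  + (a * ((L : ℝ) ^ 2)⁻¹) • blockProj L (M (C.scale X)))⁻¹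
                *ᵥ fun w => minimiser (L ^ n * L ^ C.scale X) (fine L (M (C.scale X))) (aK a L (C.scale X + n))
                    (((L ^ n * L ^ C.scale X : ℕ) : ℝ) ^ 2) m2 (Pi.single w 1) (zB X)))
        (W : Set (ℕ → ℝ)),
        NE5 EA EB W κ ((L : ℝ) ^ (-(γ / 2))) C₅ := by
  have hd0 : 0 < d := hd
  have hL2 : 2 ≤ L := by have := hLp.2; omega
  have hα1 : α < 1 := by linarith
  have hγ1 : γ ≤ 1 := by linarith
  -- the outer-line packages of n18-b BY NAME: the Hölder row (file 13), the column (file 8)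
  obtain ⟨δ₁, c₁, hδ₁, hc₁, H₁⟩ := holder_kernel_decay_blocks d L hd hLp.1 hL2 ha hm hα hα1
  obtain ⟨δ₂, c₂, hδ₂, hc₂, H₂⟩ := minimiser_col_decay d L hd hLp ha hm.le
  obtain ⟨δ₃, c₃, hδ₃, hc₃, H₃⟩ := king_prop38_holder_torus_blocks d L hd hLp.1 hL2 ha hm hα hγ hαγ
  obtain ⟨δ₄, c₄, hδ₄, hc₄, H₄⟩ := minimiser_row_rate d L hd hLp.1 hL2 ha hm hγ.le hγ1
  -- one common decay rate
  have hδ45 : 0 < delta45 d a L := delta45_pos (d := d) ha hL2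
  set κ : ℝ := min (min (min δ₁ δ₂) (min (δ₃ / 2) (δ₄ / 2))) (delta45 d a L) with hκ_def
  have hκpos : 0 < κ :=
    lt_min (lt_min (lt_min hδ₁ hδ₂) (lt_min (half_pos hδ₃) (half_pos hδ₄))) hδ45
  have hκ₁ : κ ≤ δ₁ := (min_le_left _ _).trans ((min_le_left _ _).trans (min_le_left _ _))
  have hκ₂ : κ ≤ δ₂ := (min_le_left _ _).trans ((min_le_left _ _).trans (min_le_right _ _))
  have hκ₃ : κ ≤ δ₃ / 2 := (min_le_left _ _).trans ((min_le_right _ _).trans (min_le_left _ _))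
  have hκ₄ : κ ≤ δ₄ / 2 := (min_le_left _ _).trans ((min_le_right _ _).trans (min_le_right _ _))
  have hκ45 : κ ≤ delta45 d a L := min_le_right _ _
  -- the uniform letters
  set Cu : ℝ := prop38RateConst a a (a * (2 * ((a * (1 - ((L : ℝ) ^ 2)⁻¹))⁻¹ + π ^ 2 / 48 + 1 / 3)))
      ((π ^ 2 / 4) ^ d) d γ + prop38PosConst a ((π ^ 2 / 4) ^ d) d γ with hCu
  set CuH : ℝ := fprop38RateConst a a (a * (2 * ((a * (1 - ((L : ℝ) ^ 2)⁻¹))⁻¹ + π ^ 2 / 48 + 1 / 3)))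
      ((π ^ 2 / 4) ^ d) d γ α (2 * (d : ℝ) ^ α) 0
      + fprop38PosConst a ((π ^ 2 / 4) ^ d) d γ α (2 * (d : ℝ) ^ α) (6 * (d : ℝ) ^ (α + γ)) with hCuH
  set cA : ℝ := Real.sqrt (2 * c₃ * CuH) with hcA
  set cB : ℝ := Real.sqrt (2 * (a * c₄) * Cu) with hcB
  have hcA0 : 0 ≤ cA := Real.sqrt_nonneg _
  have hcB0 : 0 ≤ cB := Real.sqrt_nonneg _
  have hsB : 0 ≤ a * c₂ := by positivity
  have hγ₀ : 0 < gam0L d a L := gam0L_pos ha hL2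
  have hK45 : 0 ≤ K45 d a L := K45_nonneg a L
  have hKd : 0 ≤ latticeConst d (κ / 2) := latticeConst_nonneg d (half_pos hκpos).le
  have hAC : 0 ≤ Literature.MathematicalPhysics.QuantumFieldTheory.King1986.aliasConst d (α + γ - 1) :=
    aliasConst_nonneg_of_lt_one hd0 (by linarith)
  refine ⟨κ / 2, 2 * ((cA * (2 / gam0L d a L) * (a * c₂) + c₁ * K45 d a L * (a * c₂)
      + c₁ * (2 / gam0L d a L) * cB) * (latticeConst d (κ / 2)) ^ 2), half_pos hκpos, by positivity, ?_⟩
  intro n hn M _ hM C hsc xA yA zA xB yB zB hx hy hz hdd EA EB hEA hEB W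
  have hγ2 : γ / 2 ≤ 1 := by linarith
  refine ne5_of_threeFactorRates_lemma45_pair (C := C) (EA := EA) (EB := EB) (W := W) L hL2 ha hm hn M hγ2 hsc
    (fun X => blockOf (L ^ C.scale X) (fine L (M (C.scale X))) (xA X))
    (fun X => blockOf (L ^ C.scale X) (fine L (M (C.scale X))) (yA X))
    (fun X => blockOf (L ^ C.scale X) (fine L (M (C.scale X))) (zA X))
    (fun X u => (holdist (L ^ C.scale X) (fine L (M (C.scale X))) (xA X) (yA X)) ^ (-α)
      * (minimiser (L ^ C.scale X) (fine L (M (C.scale X))) (aK a L (C.scale X))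
            (((L ^ C.scale X : ℕ) : ℝ) ^ 2) m2 (Pi.single u 1) (xA X)
          - minimiser (L ^ C.scale X) (fine L (M (C.scale X))) (aK a L (C.scale X))
            (((L ^ C.scale X : ℕ) : ℝ) ^ 2) m2 (Pi.single u 1) (yA X)))
    (fun X u => (holdist (L ^ n * L ^ C.scale X) (fine L (M (C.scale X))) (xB X) (yB X)) ^ (-α)
      * (minimiser (L ^ n * L ^ C.scale X) (fine L (M (C.scale X))) (aK a L (C.scale X + n))
            (((L ^ n * L ^ C.scale X : ℕ) : ℝ) ^ 2) m2 (Pi.single u 1) (xB X)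
          - minimiser (L ^ n * L ^ C.scale X) (fine L (M (C.scale X))) (aK a L (C.scale X + n))
            (((L ^ n * L ^ C.scale X : ℕ) : ℝ) ^ 2) m2 (Pi.single u 1) (yB X)))
    (fun X w => minimiser (L ^ C.scale X) (fine L (M (C.scale X))) (aK a L (C.scale X))
      (((L ^ C.scale X : ℕ) : ℝ) ^ 2) m2 (Pi.single w 1) (zA X))
    (fun X w => minimiser (L ^ n * L ^ C.scale X) (fine L (M (C.scale X))) (aK a L (C.scale X + n))
      (((L ^ n * L ^ C.scale X : ℕ) : ℝ) ^ 2) m2 (Pi.single w 1) (zB X))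
    (fun X => (effLaplacian (L ^ C.scale X) (fine L (M (C.scale X))) (aK a L (C.scale X))
        (((L ^ C.scale X : ℕ) : ℝ) ^ 2) m2 + (a * ((L : ℝ) ^ 2)⁻¹) • blockProj L (M (C.scale X)))⁻¹)
    (fun X => (effLaplacian (L ^ n * L ^ C.scale X) (fine L (M (C.scale X))) (aK a L (C.scale X + n))
        (((L ^ n * L ^ C.scale X : ℕ) : ℝ) ^ 2) m2 + (a * ((L : ℝ) ^ 2)⁻¹) • blockProj L (M (C.scale X)))⁻¹)
    (fun _ => rfl) (fun _ => rfl) hκpos hκ45 hc₁.le hsB hcA0 hcB0 ?_ ?_ ?_ ?_ hdd hEA hEB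
  · -- `hu`: run A's HÖLDER row, Theorem 3.3 (3.8) in block currency, pair-anchored (`holder_kernel_decay_blocks`)
    intro X u
    obtain ⟨mm, hmm⟩ := hM (C.scale X)
    have hMK : ∀ μ, fine L (M (C.scale X)) μ
        = (⟨d, L, mm, C.scale X, hd, hLp⟩ : Params).sitesPerDir (C.scale X) := fun μ => by
      simp only [Params.sitesPerDir, Nat.add_sub_cancel]; exact hmm μ
    have h := H₁ ⟨d, L, mm, C.scale X, hd, hLp⟩ rfl rfl (hsc X) (fine L (M (C.scale X))) hMK (L ^ C.scale X) rfl
      (xA X) (yA X) u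
    exact h.trans (exp_decay_mono hc₁.le hκ₁ (le_min (tdistT_nonneg _ _ _) (tdistT_nonneg _ _ _)))
  · -- `hv`: run B's column (`minimiser_col_decay`), the block under `z_B` is `B(z_A)` (`blockOf_over`)
    intro X w
    obtain ⟨mm, hmm⟩ := hM (C.scale X)
    have hMK : ∀ μ, fine L (M (C.scale X)) μ
        = (⟨d, L, mm, C.scale X + n, hd, hLp⟩ : Params).sitesPerDir (C.scale X + n) := fun μ => by
      simp only [Params.sitesPerDir, Nat.add_sub_cancel]; exact hmm μ
    have hN : L ^ n * L ^ C.scale X = L ^ (C.scale X + n) := by rw [pow_add, mul_comm]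
    have h := H₂ ⟨d, L, mm, C.scale X + n, hd, hLp⟩ rfl rfl (show 1 ≤ C.scale X + n by have := hsc X; omega)
      (fine L (M (C.scale X))) hMK (L ^ n * L ^ C.scale X) hN κ hκpos hκ₂ (zB X) w
    rw [blockOf_over (fine L (M (C.scale X))) (zA X) (zB X) (hz X)] at h
    exact h
  · -- `hdu`: the HÖLDER row difference, (3.71) line 3 in its printed shape (`king_prop38_holder_torus_blocks`), its
    -- constant made `K, n`-free (`fprop38Const_le_unif`, `sqrt_rate_le_unif`), decay weakened from `δ₃∕2` to `κ`
    intro X u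
    obtain ⟨mm, hmm⟩ := hM (C.scale X)
    have hMK : ∀ μ, fine L (M (C.scale X)) μ
        = (⟨d, L, mm, C.scale X, hd, hLp⟩ : Params).sitesPerDir (C.scale X) := fun μ => by
      simp only [Params.sitesPerDir, Nat.add_sub_cancel]; exact hmm μ
    haveI : NeZero (⟨d, L, mm, C.scale X, hd, hLp⟩ : Params).L := ‹NeZero L›
    have h := H₃ ⟨d, L, mm, C.scale X, hd, hLp⟩ rfl rfl (hsc X) n hn (fine L (M (C.scale X))) hMK
      (xA X) (yA X) (xB X) (yB X) u (hx X) (hy X)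
    have hm0 : 0 ≤ min (tdistT (fine L (M (C.scale X))) (blockOf (L ^ C.scale X) (fine L (M (C.scale X))) (xA X)) u)
        (tdistT (fine L (M (C.scale X))) (blockOf (L ^ C.scale X) (fine L (M (C.scale X))) (yA X)) u) :=
      le_min (tdistT_nonneg _ _ _) (tdistT_nonneg _ _ _)
    refine (h.trans (exp_decay_mono (Real.sqrt_nonneg _) hκ₃ hm0)).trans ?_
    refine mul_le_mul_of_nonneg_right ?_ (Real.exp_pos _).le
    exact sqrt_rate_le_unif (fprop38Const_le_unif ha hL2 (hsc X) hn (by positivity) (by positivity) hAC)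
      (by positivity) L (C.scale X) γ
  · -- `hdv`: the column difference, (3.71) line 1 (`minimiser_row_rate`) by symmetry of the torus distance
    intro X w
    obtain ⟨mm, hmm⟩ := hM (C.scale X)
    have hMK : ∀ μ, fine L (M (C.scale X)) μ
        = (⟨d, L, mm, C.scale X, hd, hLp⟩ : Params).sitesPerDir (C.scale X) := fun μ => by
      simp only [Params.sitesPerDir, Nat.add_sub_cancel]; exact hmm μ
    haveI : NeZero (⟨d, L, mm, C.scale X, hd, hLp⟩ : Params).L := ‹NeZero L›
    have h := H₄ ⟨d, L, mm, C.scale X, hd, hLp⟩ rfl rfl (hsc X) n hn (fine L (M (C.scale X))) hMK κ hκpos hκ₄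
      (zA X) (zB X) w (hz X)
    rw [tdistT_symm (fine L (M (C.scale X))) w]
    exact h.trans (mul_le_mul_of_nonneg_right (outerRate_le_unif hd0 ha hL2 (hsc X) hn hγ1 hc₄.le)
      (Real.exp_pos _).le)

-- The letters have CONTENT (`0 < L^{−γ∕2} < 1` for `γ > 0`, `κ > 0`): `N18KingModelTorus.ne5_kingModel_threeFactor_letters`.

/-! ## §2 A LITERAL inhabitant: the Hölder graphs on King's own carriers (§1's binders jointly satisfiable, `d X` = King's
`dist({B(x), B(y)}, B(z))`) -/

/-- **§1 INHABITED IN THE KERNEL WITH `d X` = THE ACTUAL `dist({B(x), B(y)}, B(z))`.**  On the LITERAL carriers whose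
domains are a scale `j` (creation scale `j + 1`) and a TRIPLE of run-B fine points `x′, y′, z′ ∈ T_{η′}` (`η′ = L^{−j−1−n}`),
with tree length `d X := min(|B(x) − B(z)|_{T₁}, |B(y) − B(z)|_{T₁})` for the run-A points `x, y, z` under `x′, y′, z′`
(King: «that point in T_η for which x′ ∈ B^n(x)»), trivial backgrounds, transport `id`, gauge `0`, the two functionals
reading the Hölder graphs `(∂_α(x, y)G^{(j+1)})(z)` of run A and `(∂_α(x′, y′)G^{(j+1+n)})(z′)` of run B satisfy
`NE5 … κ (L^{−γ∕2}) C₅` with §1's letters, for EVERY `n ≥ 1`, every Bałaban unit torus `L·M′(μ) = 2L^{m}` and every window —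
§1 with `hx`, `hy`, `hz` ≔ `N18KingModel.coarse_val`, `hd` ≔ `le_rfl`, `hEA`, `hEB` ≔ `rfl`: the binders of §1 are jointly
satisfiable and the decay factor is not idle. [cite: King1986, Prop. 3.9 (3.75) p.665, (4.42) p.675] -/
theorem ne5_kingModel_threeFactorHolder_inhabited (hd : 1 ≤ d) (L : ℕ) [NeZero L] (hLp : Odd L ∧ 1 < L) {a m2 : ℝ}
    (ha : 0 < a) (hm : 0 < m2) {α γ : ℝ} (hα : 0 < α) (hγ : 0 < γ) (hαγ : α + γ ≤ 1) :
    ∃ κ C₅ : ℝ, 0 < κ ∧ 0 ≤ C₅ ∧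
      ∀ (n : ℕ) (_hn : 1 ≤ n) (M' : Fin d → ℕ) [∀ μ, NeZero (M' μ)] (_hM' : ∃ mm : ℕ, ∀ μ, L * M' μ = 2 * L ^ mm)
        (W : Set (ℕ → ℝ)),
        NE5 (C := { Dom := Σ j : ℕ, Tor (fine (L ^ n * L ^ (j + 1)) (fine L M'))
                                  × Tor (fine (L ^ n * L ^ (j + 1)) (fine L M'))
                                  × Tor (fine (L ^ n * L ^ (j + 1)) (fine L M')),
                    scale := fun X => X.1 + 1,
                    d := fun X => min
                      (tdistT (fine L M')
                        (blockOf (L ^ (X.1 + 1)) (fine L M')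
                          (fun μ => (((X.2.1 μ).val / L ^ n : ℕ) : ZMod (fine (L ^ (X.1 + 1)) (fine L M') μ))))
                        (blockOf (L ^ (X.1 + 1)) (fine L M')
                          (fun μ => (((X.2.2.2 μ).val / L ^ n : ℕ) : ZMod (fine (L ^ (X.1 + 1)) (fine L M') μ)))))
                      (tdistT (fine L M')
                        (blockOf (L ^ (X.1 + 1)) (fine L M')
                          (fun μ => (((X.2.2.1 μ).val / L ^ n : ℕ) : ZMod (fine (L ^ (X.1 + 1)) (fine L M') μ))))
                        (blockOf (L ^ (X.1 + 1)) (fine L M')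
                          (fun μ => (((X.2.2.2 μ).val / L ^ n : ℕ) : ZMod (fine (L ^ (X.1 + 1)) (fine L M') μ))))),
                    d_nonneg := fun _ => le_min (tdistT_nonneg _ _ _) (tdistT_nonneg _ _ _),
                    BgA := PUnit, BgB := PUnit, gauge := fun _ _ => 0, gauge_nonneg := fun _ _ => le_rfl,
                    transport := id })
          (fun (_ : ℕ → ℝ) (_ : PUnit)
              (X : Σ j : ℕ, Tor (fine (L ^ n * L ^ (j + 1)) (fine L M')) × Tor (fine (L ^ n * L ^ (j + 1)) (fine L M'))
                            × Tor (fine (L ^ n * L ^ (j + 1)) (fine L M'))) =>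
            (fun u => (holdist (L ^ (X.1 + 1)) (fine L M')
                  (fun μ => (((X.2.1 μ).val / L ^ n : ℕ) : ZMod (fine (L ^ (X.1 + 1)) (fine L M') μ)))
                  (fun μ => (((X.2.2.1 μ).val / L ^ n : ℕ) : ZMod (fine (L ^ (X.1 + 1)) (fine L M') μ)))) ^ (-α)
                * (minimiser (L ^ (X.1 + 1)) (fine L M') (aK a L (X.1 + 1)) (((L ^ (X.1 + 1) : ℕ) : ℝ) ^ 2) m2
                      (Pi.single u 1)
                      (fun μ => (((X.2.1 μ).val / L ^ n : ℕ) : ZMod (fine (L ^ (X.1 + 1)) (fine L M') μ)))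
                    - minimiser (L ^ (X.1 + 1)) (fine L M') (aK a L (X.1 + 1)) (((L ^ (X.1 + 1) : ℕ) : ℝ) ^ 2) m2
                      (Pi.single u 1)
                      (fun μ => (((X.2.2.1 μ).val / L ^ n : ℕ) : ZMod (fine (L ^ (X.1 + 1)) (fine L M') μ)))))
              ⬝ᵥ ((effLaplacian (L ^ (X.1 + 1)) (fine L M') (aK a L (X.1 + 1)) (((L ^ (X.1 + 1) : ℕ) : ℝ) ^ 2) m2
                      + (a * ((L : ℝ) ^ 2)⁻¹) • blockProj L M')⁻¹
                  *ᵥ fun w => minimiser (L ^ (X.1 + 1)) (fine L M') (aK a L (X.1 + 1))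
                      (((L ^ (X.1 + 1) : ℕ) : ℝ) ^ 2) m2 (Pi.single w 1)
                      (fun μ => (((X.2.2.2 μ).val / L ^ n : ℕ) : ZMod (fine (L ^ (X.1 + 1)) (fine L M') μ)))))
          (fun (_ : ℕ → ℝ) (_ : PUnit)
              (X : Σ j : ℕ, Tor (fine (L ^ n * L ^ (j + 1)) (fine L M')) × Tor (fine (L ^ n * L ^ (j + 1)) (fine L M'))
                            × Tor (fine (L ^ n * L ^ (j + 1)) (fine L M'))) =>
            (fun u => (holdist (L ^ n * L ^ (X.1 + 1)) (fine L M') X.2.1 X.2.2.1) ^ (-α)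
                * (minimiser (L ^ n * L ^ (X.1 + 1)) (fine L M') (aK a L (X.1 + 1 + n))
                      (((L ^ n * L ^ (X.1 + 1) : ℕ) : ℝ) ^ 2) m2 (Pi.single u 1) X.2.1
                    - minimiser (L ^ n * L ^ (X.1 + 1)) (fine L M') (aK a L (X.1 + 1 + n))
                      (((L ^ n * L ^ (X.1 + 1) : ℕ) : ℝ) ^ 2) m2 (Pi.single u 1) X.2.2.1))
              ⬝ᵥ ((effLaplacian (L ^ n * L ^ (X.1 + 1)) (fine L M') (aK a L (X.1 + 1 + n))
                      (((L ^ n * L ^ (X.1 + 1) : ℕ) : ℝ) ^ 2) m2 + (a * ((L : ℝ) ^ 2)⁻¹) • blockProj L M')⁻¹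
                  *ᵥ fun w => minimiser (L ^ n * L ^ (X.1 + 1)) (fine L M') (aK a L (X.1 + 1 + n))
                      (((L ^ n * L ^ (X.1 + 1) : ℕ) : ℝ) ^ 2) m2 (Pi.single w 1) X.2.2.2))
          W κ ((L : ℝ) ^ (-(γ / 2))) C₅ := by
  obtain ⟨κ, C₅, hκ, hC₅, H⟩ := ne5_kingModel_threeFactorHolder_torus hd L hLp ha hm hα hγ hαγ
  refine ⟨κ, C₅, hκ, hC₅, ?_⟩
  intro n hn M' _ hM' W
  have hLn : 0 < L ^ n := pow_pos (Nat.pos_of_ne_zero (NeZero.ne L)) n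
  -- the carriers literal is repeated so that the reading maps elaborate against a closed structure
  exact H n hn (fun _ => M') (fun _ => hM')
    { Dom := Σ j : ℕ, Tor (fine (L ^ n * L ^ (j + 1)) (fine L M')) × Tor (fine (L ^ n * L ^ (j + 1)) (fine L M'))
                    × Tor (fine (L ^ n * L ^ (j + 1)) (fine L M')),
      scale := fun X => X.1 + 1,
      d := fun X => min
        (tdistT (fine L M')
          (blockOf (L ^ (X.1 + 1)) (fine L M')
            (fun μ => (((X.2.1 μ).val / L ^ n : ℕ) : ZMod (fine (L ^ (X.1 + 1)) (fine L M') μ))))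
          (blockOf (L ^ (X.1 + 1)) (fine L M')
            (fun μ => (((X.2.2.2 μ).val / L ^ n : ℕ) : ZMod (fine (L ^ (X.1 + 1)) (fine L M') μ)))))
        (tdistT (fine L M')
          (blockOf (L ^ (X.1 + 1)) (fine L M')
            (fun μ => (((X.2.2.1 μ).val / L ^ n : ℕ) : ZMod (fine (L ^ (X.1 + 1)) (fine L M') μ))))
          (blockOf (L ^ (X.1 + 1)) (fine L M')
            (fun μ => (((X.2.2.2 μ).val / L ^ n : ℕ) : ZMod (fine (L ^ (X.1 + 1)) (fine L M') μ))))),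
      d_nonneg := fun _ => le_min (tdistT_nonneg _ _ _) (tdistT_nonneg _ _ _),
      BgA := PUnit, BgB := PUnit, gauge := fun _ _ => 0, gauge_nonneg := fun _ _ => le_rfl, transport := id }
    (fun _ => Nat.succ_le_succ (Nat.zero_le _))
    (fun X μ => (((X.2.1 μ).val / L ^ n : ℕ) : ZMod (fine (L ^ (X.1 + 1)) (fine L M') μ)))
    (fun X μ => (((X.2.2.1 μ).val / L ^ n : ℕ) : ZMod (fine (L ^ (X.1 + 1)) (fine L M') μ)))
    (fun X μ => (((X.2.2.2 μ).val / L ^ n : ℕ) : ZMod (fine (L ^ (X.1 + 1)) (fine L M') μ)))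
    (fun X => X.2.1) (fun X => X.2.2.1) (fun X => X.2.2.2)
    (fun X μ => coarse_val hLn X.2.1 μ) (fun X μ => coarse_val hLn X.2.2.1 μ) (fun X μ => coarse_val hLn X.2.2.2 μ)
    (fun _ => le_rfl) _ _ (fun _ _ _ => rfl) (fun _ _ _ => rfl) W

end Summit.QuantumFields.YangMills.BalabanUVNodes.N18KingModelTorusHolder

end
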